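import Summits.AtomisticToContinuum.FouriersLaw.Theorems.BondHeatUncertaintyExtensiveSnapshotIrreversibilityWeightedOddDQMAux1

/-!
# Weighted odd differentiability in quadratic mean (stub S_H2 of line `hellinger-logmean`), II: assembly of clause (ii) from tightness and local convergence

Helper file 2 (`--supports stmt-AtomisticToContinuum-9121`, crux `BondHeatUncertainty.ExtensiveSnapshotIrreversibility`)
for stub `stub_weightedOddDQM` (S_H2): the REAL-ANALYSIS REDUCTION of clause (ii) (the weighted odd DQM limit
`δ⁻² ∫ (s_δ - s_δ∘Θ)² cosh(η(1+H)) dx → ¼ ∫ (h - h∘Θ)² cosh(η(1+H)) dμ_{N,T,T}`, `0 < η < η₀`) to two explicit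
inputs on a measurable square-root density family `s_δ` of the NESS:
(H1) **weighted tightness** `∫ (s_δ - s_δ∘Θ)² e^{η₀ H} dx ≤ C δ²` eventually in `δ ≠ 0` (integrand integrable);
(H2) **local quadratic-mean convergence of the odd difference quotient**: on every energy sublevel set
`{H ≤ R}`, `δ⁻¹ (s_δ - s_δ∘Θ) → ½ (h - h∘Θ) √ρ_T` in `L²({H ≤ R}, dx)`, `ρ_T = e^{-H/T}/Z_T`.
Pipeline: `tendsto_setIntegral_sq_mul_of_tendsto_setIntegral_sub_sq` (`L²(S)`-convergence moves
bounded-weight quadratic integrals; AM–GM splitting `2t|a² - b²| ≤ (1 + 2t²)(a - b)² + 8t² b²`),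
`tendsto_integral_of_local_of_tight` (exhausting sets + uniformly small tails + integrable limit, `ε/3`),
`weightedOddDQM_of_tight_of_local` (the chain assembly: `{H ≤ n}` exhaust phase space,
`cosh(η(1+H)) ≤ cosh(η(1+n))` on `{H ≤ n}`, the tail gap `cosh(η(1+H)) ≤ e^{η} e^{-(η₀-η)n} e^{η₀H}` on `{H > n}`,
`∫ (½(h-h∘Θ)√ρ_T)² cosh dx = ¼ ∫ (h-h∘Θ)² cosh dμ_T`, integrable by helper file 1), and the registered closed
form `helper_weightedOddDQMAssembly`. References: L. Le Cam, Asymptotic Methods in Statistical Decision Theory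
(1986), §17.3 (differentiability in quadratic mean); folklore. No definitions; nothing here closes the item.
-/

noncomputable section

namespace Summit.AtomisticToContinuum.FouriersLaw.Theorems.ExtensiveSnapshotIrreversibility.HellingerLogMean

open MeasureTheory Filter Topology Set
open scoped ENNReal NNReal ContDiff
open Literature.MathematicalPhysics.KineticTheory.HeatConduction
open Summit.AtomisticToContinuum.FouriersLaw.Theorems.OddSectorIrreversibility
open Summit.AtomisticToContinuum.FouriersLaw.Theorems.OddSectorIrreversibility.Corrector

/-! ## Two abstract convergence lemmas -/

/-- AM–GM splitting of `|a² - b²| = |a - b| |a + b|`: for every real `t`,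
`2t |a² - b²| ≤ (1 + 2t²)(a - b)² + 8t² b²` (the difference is a sum of two squares). [folklore] -/
theorem two_mul_abs_sq_sub_sq_le (a b t : ℝ) :
    2 * t * |a ^ 2 - b ^ 2| ≤ (1 + 2 * t ^ 2) * (a - b) ^ 2 + 8 * t ^ 2 * b ^ 2 := by
  rcases abs_cases (a ^ 2 - b ^ 2) with ⟨h, _⟩ | ⟨h, _⟩ <;> rw [h]
  · nlinarith [sq_nonneg (a - b - t * (a + b)), sq_nonneg (a - b - 2 * b)]
  · nlinarith [sq_nonneg (a - b + t * (a + b)), sq_nonneg (a - b - 2 * b)]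

/-- `K · ε/(4(K+1)) < ε/2` for `K ≥ 0`, `ε > 0`. [folklore] -/
theorem mul_eps_div_lt_half {K ε : ℝ} (hK : 0 ≤ K) (hε : 0 < ε) : K * (ε / (4 * (K + 1))) < ε / 2 := by
  rw [mul_div_assoc', div_lt_div_iff₀ (by positivity) (by norm_num)]
  nlinarith

/-- **`L²(S)`-convergence moves bounded-weight quadratic integrals.** On a set `S` with a weight
`0 ≤ w ≤ W` (a.e. on `S`): if `G² ∈ L¹(S)`, eventually `(F_i - G)² ∈ L¹(S)` and
`∫_S (F_i - G)² → 0`, then `∫_S F_i² w → ∫_S G² w`. Elementary (AM–GM splitting of `|F_i² - G²|`).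
[folklore] -/
theorem tendsto_setIntegral_sq_mul_of_tendsto_setIntegral_sub_sq {X : Type*} [MeasurableSpace X]
    {ν : Measure X} {ι : Type*} {l : Filter ι} {S : Set X} {w : X → ℝ} {W : ℝ} (hW : 0 ≤ W)
    (hwm : AEStronglyMeasurable w (ν.restrict S))
    (hw0 : ∀ᵐ x ∂(ν.restrict S), 0 ≤ w x) (hwW : ∀ᵐ x ∂(ν.restrict S), w x ≤ W)
    {F : ι → X → ℝ} {G : X → ℝ}
    (hFm : ∀ᶠ i in l, AEStronglyMeasurable (F i) (ν.restrict S))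
    (hG2 : Integrable (fun x => G x ^ 2) (ν.restrict S))
    (hFG : ∀ᶠ i in l, Integrable (fun x => (F i x - G x) ^ 2) (ν.restrict S))
    (hlim : Tendsto (fun i => ∫ x in S, (F i x - G x) ^ 2 ∂ν) l (𝓝 0)) :
    Tendsto (fun i => ∫ x in S, F i x ^ 2 * w x ∂ν) l (𝓝 (∫ x in S, G x ^ 2 * w x ∂ν)) := by
  rw [Metric.tendsto_nhds]
  intro ε hε
  set IG : ℝ := ∫ x in S, G x ^ 2 ∂ν with hIG
  have hIG0 : 0 ≤ IG := integral_nonneg fun x => sq_nonneg _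
  set K₁ : ℝ := 4 * W * IG with hK₁
  have hK₁0 : 0 ≤ K₁ := by positivity
  set t : ℝ := ε / (4 * (K₁ + 1)) with ht
  have ht0 : 0 < t := by positivity
  set K₂ : ℝ := W * (1 / (2 * t) + t) with hK₂
  have hK₂0 : 0 ≤ K₂ := by positivity
  set ε' : ℝ := ε / (4 * (K₂ + 1)) with hε'
  have hε'0 : 0 < ε' := by positivity
  have hd : ∀ᶠ i in l, ∫ x in S, (F i x - G x) ^ 2 ∂ν < ε' := by
    filter_upwards [Metric.tendsto_nhds.1 hlim ε' hε'0] with i hi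
    rw [Real.dist_eq, sub_zero] at hi
    exact lt_of_abs_lt hi
  have hwb : ∀ᵐ x ∂(ν.restrict S), ‖w x‖ ≤ W := by
    filter_upwards [hw0, hwW] with x h0 h1
    rw [Real.norm_eq_abs, abs_of_nonneg h0]; exact h1
  have hGw : Integrable (fun x => G x ^ 2 * w x) (ν.restrict S) := hG2.mul_bdd hwm hwb
  filter_upwards [hFm, hFG, hd] with i hFmi hFGi hdi
  set d : ℝ := ∫ x in S, (F i x - G x) ^ 2 ∂ν with hdd
  have hd0 : 0 ≤ d := integral_nonneg fun x => sq_nonneg _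
  have hF2 : Integrable (fun x => F i x ^ 2) (ν.restrict S) := by
    refine Integrable.mono' ((hFGi.const_mul 2).add (hG2.const_mul 2)) (hFmi.pow 2) ?_
    refine Eventually.of_forall fun x => ?_
    rw [Real.norm_eq_abs, abs_of_nonneg (sq_nonneg _)]
    show F i x ^ 2 ≤ 2 * (F i x - G x) ^ 2 + 2 * G x ^ 2
    nlinarith [sq_nonneg (F i x - G x - G x)]
  have hFw : Integrable (fun x => F i x ^ 2 * w x) (ν.restrict S) := hF2.mul_bdd hwm hwb
  have hmaj : Integrable (fun x => 1 / (2 * t) * ((1 + 2 * t ^ 2) * (F i x - G x) ^ 2 +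
      8 * t ^ 2 * G x ^ 2) * W) (ν.restrict S) :=
    ((((hFGi.const_mul _).add (hG2.const_mul _)).const_mul _).mul_const _)
  rw [Real.dist_eq, ← integral_sub hFw hGw]
  calc |∫ x in S, (F i x ^ 2 * w x - G x ^ 2 * w x) ∂ν|
      ≤ ∫ x in S, 1 / (2 * t) * ((1 + 2 * t ^ 2) * (F i x - G x) ^ 2 + 8 * t ^ 2 * G x ^ 2) * W ∂ν := by
        rw [← Real.norm_eq_abs]
        refine norm_integral_le_of_norm_le hmaj ?_
        filter_upwards [hw0, hwW] with x h0 h1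
        rw [Real.norm_eq_abs, ← sub_mul, abs_mul, abs_of_nonneg h0]
        have key := two_mul_abs_sq_sub_sq_le (F i x) (G x) t
        have h2 : |F i x ^ 2 - G x ^ 2| ≤
            1 / (2 * t) * ((1 + 2 * t ^ 2) * (F i x - G x) ^ 2 + 8 * t ^ 2 * G x ^ 2) := by
          rw [one_div, ← div_eq_inv_mul, le_div_iff₀' (by positivity)]
          exact key
        exact mul_le_mul h2 h1 h0 (by positivity)
    _ = 1 / (2 * t) * ((1 + 2 * t ^ 2) * d + 8 * t ^ 2 * IG) * W := by
        rw [integral_mul_const, integral_const_mul, integral_add (hFGi.const_mul _) (hG2.const_mul _),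
          integral_const_mul, integral_const_mul]
    _ = K₂ * d + K₁ * t := by
        rw [hK₂, hK₁]
        field_simp
        ring
    _ < ε := by
        have h1 : K₁ * t < ε / 2 := mul_eps_div_lt_half hK₁0 hε
        have h2 : K₂ * d ≤ K₂ * ε' := mul_le_mul_of_nonneg_left hdi.le hK₂0
        have h3 : K₂ * ε' < ε / 2 := mul_eps_div_lt_half hK₂0 hε
        linarith

/-- **Local convergence + tightness ⇒ convergence of the integrals.** For an exhausting monotone
sequence of measurable sets `S_n`, nonnegative eventually-integrable `f_i`, an integrable `g`:
if `∫_{S_n} f_i → ∫_{S_n} g` for every `n` and the tails `∫_{S_nᶜ} f_i` are `≤ ε` for `n` large,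
eventually in `i`, then `∫ f_i → ∫ g`. [folklore] -/
theorem tendsto_integral_of_local_of_tight {X : Type*} [MeasurableSpace X] {ν : Measure X}
    {ι : Type*} {l : Filter ι} {S : ℕ → Set X} (hS : ∀ n, MeasurableSet (S n)) (hmono : Monotone S)
    (hU : (⋃ n, S n) = Set.univ) {f : ι → X → ℝ} {g : X → ℝ} (hg : Integrable g ν)
    (hf : ∀ᶠ i in l, Integrable (f i) ν) (hf0 : ∀ᶠ i in l, ∀ x, 0 ≤ f i x)
    (hloc : ∀ n, Tendsto (fun i => ∫ x in S n, f i x ∂ν) l (𝓝 (∫ x in S n, g x ∂ν)))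
    (htight : ∀ ε : ℝ, 0 < ε → ∀ᶠ n in atTop, ∀ᶠ i in l, ∫ x in (S n)ᶜ, f i x ∂ν ≤ ε) :
    Tendsto (fun i => ∫ x, f i x ∂ν) l (𝓝 (∫ x, g x ∂ν)) := by
  rw [Metric.tendsto_nhds]
  intro ε hε
  have hε3 : 0 < ε / 3 := by positivity
  have hglim : Tendsto (fun n => ∫ x in S n, g x ∂ν) atTop (𝓝 (∫ x, g x ∂ν)) := by
    have hgi : IntegrableOn g (⋃ n, S n) ν := hg.integrableOn
    have h := tendsto_setIntegral_of_monotone hS hmono hgi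
    rwa [hU, setIntegral_univ] at h
  have h1 : ∀ᶠ n in atTop, |(∫ x in S n, g x ∂ν) - ∫ x, g x ∂ν| < ε / 3 := by
    filter_upwards [Metric.tendsto_nhds.1 hglim (ε / 3) hε3] with n hn
    rwa [Real.dist_eq] at hn
  obtain ⟨n, hn1, hn2⟩ := (h1.and (htight (ε / 3) hε3)).exists
  filter_upwards [hf, hf0, hn2, Metric.tendsto_nhds.1 (hloc n) (ε / 3) hε3] with i hfi hf0i hti hli
  rw [Real.dist_eq] at hli ⊢
  have hsplit := integral_add_compl (hS n) hfi
  have htail0 : 0 ≤ ∫ x in (S n)ᶜ, f i x ∂ν := integral_nonneg fun x => hf0i x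
  rw [← hsplit]
  calc |(∫ x in S n, f i x ∂ν) + (∫ x in (S n)ᶜ, f i x ∂ν) - ∫ x, g x ∂ν|
      = |((∫ x in S n, f i x ∂ν) - ∫ x in S n, g x ∂ν) + (∫ x in (S n)ᶜ, f i x ∂ν) +
          ((∫ x in S n, g x ∂ν) - ∫ x, g x ∂ν)| := by ring_nf
    _ ≤ |(∫ x in S n, f i x ∂ν) - ∫ x in S n, g x ∂ν| + |∫ x in (S n)ᶜ, f i x ∂ν| +
          |(∫ x in S n, g x ∂ν) - ∫ x, g x ∂ν| := abs_add_three _ _ _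
    _ < ε := by
        rw [abs_of_nonneg htail0]
        linarith

/-! ## The chain assembly -/

/-- **Tail weight gap.** For `0 < η < η₀`, `H ≥ 0` and `n ≤ H`:
`cosh(η(1+H)) ≤ e^{η} (e^{-(η₀-η)})^n e^{η₀ H}`. [folklore] -/
theorem cosh_le_tail_gap {η η₀ H : ℝ} {n : ℕ} (hη : 0 < η) (hηη₀ : η < η₀) (hH : 0 ≤ H)
    (hn : (n : ℝ) ≤ H) :
    Real.cosh (η * (1 + H)) ≤ Real.exp η * Real.exp (-(η₀ - η)) ^ n * Real.exp (η₀ * H) := by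
  have h1 := cosh_mul_one_add_le (η₁ := η) (abs_of_pos hη).le hH
  have h2 : Real.exp (η * H) ≤ Real.exp (-(η₀ - η)) ^ n * Real.exp (η₀ * H) := by
    rw [← Real.exp_nat_mul, ← Real.exp_add]
    exact Real.exp_le_exp.2 (by nlinarith)
  calc Real.cosh (η * (1 + H)) ≤ Real.exp η * Real.exp (η * H) := h1
    _ ≤ Real.exp η * (Real.exp (-(η₀ - η)) ^ n * Real.exp (η₀ * H)) :=
        mul_le_mul_of_nonneg_left h2 (Real.exp_pos _).le
    _ = _ := by ring

section Pinned

variable {N : ℕ} {ω₂ lam β γ : ℝ} (hω : 0 < ω₂) (hl : 0 < lam) (hβ : 0 < β) (hγ : 0 < γ)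
  (hU : ∀ (N : ℕ) (T_L T_R : ℝ), 0 < T_L → 0 < T_R → ∀ μ ν : Measure (PhaseSpace N),
    (pinnedChain ω₂ lam β γ).IsSteadyState N T_L T_R μ →
    (pinnedChain ω₂ lam β γ).IsSteadyState N T_L T_R ν → μ = ν)
  {μ : (N : ℕ) → ℝ → ℝ → Measure (PhaseSpace N)}
  (hμ : ∀ (N : ℕ) (T_L T_R : ℝ), 0 < T_L → 0 < T_R →
    (pinnedChain ω₂ lam β γ).IsSteadyState N T_L T_R (μ N T_L T_R))
  {T : ℝ} (hT : 0 < T) (hN : 2 ≤ N) {h : PhaseSpace N → ℝ}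
  (hh : MemLp h 2 (μ N T T) ∧
    (∀ F : PhaseSpace N → ℝ, ContDiff ℝ ((⊤ : ℕ∞) : WithTop ℕ∞) F → HasCompactSupport F →
      Tendsto (fun δ : ℝ => ((∫ x, F x ∂(μ N (T + δ / 2) (T - δ / 2))) - ∫ x, F x ∂(μ N T T)) / δ)
        (𝓝[≠] (0 : ℝ)) (𝓝 (∫ x, F x * h x ∂(μ N T T)))) ∧
    (∀ i : Fin N, Tendsto (fun δ : ℝ =>
        ((∫ x, (pinnedChain ω₂ lam β γ).bondCurrent N i x ∂(μ N (T + δ / 2) (T - δ / 2))) -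
          ∫ x, (pinnedChain ω₂ lam β γ).bondCurrent N i x ∂(μ N T T)) / δ)
        (𝓝[≠] (0 : ℝ)) (𝓝 (∫ x, (pinnedChain ω₂ lam β γ).bondCurrent N i x * h x ∂(μ N T T)))))
include hω hl hβ hγ hU hμ hT hN hh

/-- **Clause (ii) of S_H2 from weighted tightness (H1) and local quadratic-mean convergence (H2).**
Under weak-NESS uniqueness, along a steady-state family, for `T > 0`, `N ≥ 2`, an `L²` response
density `h`, `η₀ ≤ 1/T`, and a measurable family `s_δ`: if
(H1) `∫ (s_δ - s_δ∘Θ)² e^{η₀H} dx ≤ C δ²` eventually in `δ ≠ 0` (integrand integrable), and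
(H2) for every `R`, `δ⁻¹(s_δ - s_δ∘Θ) → ½(h - h∘Θ)√ρ_T` in `L²({H ≤ R}, dx)` along `δ → 0`, `δ ≠ 0`
(squared difference integrable on `{H ≤ R}` eventually), then for every `0 < η < η₀` the weighted
odd Hellinger integrand `(s_δ - s_δ∘Θ)² cosh(η(1+H))` is eventually `dx`-integrable and
`δ⁻² ∫ (s_δ - s_δ∘Θ)² cosh(η(1+H)) dx → ¼ ∫ (h - h∘Θ)² cosh(η(1+H)) dμ_{N,T,T}`.
[folklore] -/
theorem weightedOddDQM_of_tight_of_local {η₀ : ℝ} (hη₀T : η₀ ≤ 1 / T)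
    {s : ℝ → PhaseSpace N → ℝ} (hs : ∀ δ, Measurable (s δ))
    (H1 : ∃ C : ℝ, ∀ᶠ δ in 𝓝[≠] (0 : ℝ),
      Integrable (fun x : PhaseSpace N => (s δ x - s δ (x.1, -x.2)) ^ 2 *
        Real.exp (η₀ * (pinnedChain ω₂ lam β γ).hamiltonian N x)) (volume : Measure (PhaseSpace N)) ∧
      ∫ x, (s δ x - s δ (x.1, -x.2)) ^ 2 * Real.exp (η₀ * (pinnedChain ω₂ lam β γ).hamiltonian N x)
        ∂(volume : Measure (PhaseSpace N)) ≤ C * δ ^ 2)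
    (H2 : ∀ R : ℝ, (∀ᶠ δ in 𝓝[≠] (0 : ℝ), IntegrableOn (fun x : PhaseSpace N =>
        (δ⁻¹ * (s δ x - s δ (x.1, -x.2)) - (1 / 2 : ℝ) * (h x - h (x.1, -x.2)) *
          Real.sqrt ((pinnedChain ω₂ lam β γ).gibbsDensity N T x /
            ∫ y, (pinnedChain ω₂ lam β γ).gibbsDensity N T y)) ^ 2)
        {x | (pinnedChain ω₂ lam β γ).hamiltonian N x ≤ R} (volume : Measure (PhaseSpace N))) ∧
      Tendsto (fun δ : ℝ => ∫ x in {x | (pinnedChain ω₂ lam β γ).hamiltonian N x ≤ R},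
        (δ⁻¹ * (s δ x - s δ (x.1, -x.2)) - (1 / 2 : ℝ) * (h x - h (x.1, -x.2)) *
          Real.sqrt ((pinnedChain ω₂ lam β γ).gibbsDensity N T x /
            ∫ y, (pinnedChain ω₂ lam β γ).gibbsDensity N T y)) ^ 2 ∂(volume : Measure (PhaseSpace N)))
        (𝓝[≠] (0 : ℝ)) (𝓝 0))
    {η : ℝ} (hη : 0 < η) (hηη₀ : η < η₀) :
    (∀ᶠ δ in 𝓝[≠] (0 : ℝ), Integrable (fun x : PhaseSpace N => (s δ x - s δ (x.1, -x.2)) ^ 2 *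
        Real.cosh (η * (1 + (pinnedChain ω₂ lam β γ).hamiltonian N x))) (volume : Measure (PhaseSpace N))) ∧
    Tendsto (fun δ : ℝ => (δ ^ 2)⁻¹ * ∫ x, (s δ x - s δ (x.1, -x.2)) ^ 2 *
        Real.cosh (η * (1 + (pinnedChain ω₂ lam β γ).hamiltonian N x)) ∂(volume : Measure (PhaseSpace N)))
      (𝓝[≠] (0 : ℝ))
      (𝓝 ((1 / 4 : ℝ) * ∫ x, (h x - h (x.1, -x.2)) ^ 2 *
        Real.cosh (η * (1 + (pinnedChain ω₂ lam β γ).hamiltonian N x)) ∂(μ N T T))) := by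
  have hG := ness_eq_gibbs (N := N) hω hl hβ hU hμ hT
  have hηT : |η| < 1 / T := by rw [abs_of_pos hη]; linarith
  have hlimInt := integrable_oddResponse_sq_mul_cosh hω hl hβ hγ hU hμ hT hN hh hηT
  obtain ⟨hmem, -, -⟩ := hh
  set P := pinnedChain ω₂ lam β γ with hP
  set Hm : PhaseSpace N → ℝ := P.hamiltonian N with hHm
  have hHc : Continuous Hm := pinnedChain_continuous_hamiltonian ω₂ lam β γ N
  have hH0 : ∀ x, 0 ≤ Hm x := fun x => pinnedChain_hamiltonian_nonneg hω.le hl.le hβ.le γ N x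
  have hΘm : Measurable fun x : PhaseSpace N => (x.1, -x.2) := measurable_fst.prodMk measurable_snd.neg
  set v : PhaseSpace N → ℝ := fun x => Real.cosh (η * (1 + Hm x)) with hv
  have hvc : Continuous v := Real.continuous_cosh.comp (continuous_const.mul (continuous_const.add hHc))
  have hv1 : ∀ x, 1 ≤ v x := fun x => Real.one_le_cosh _
  have hv0 : ∀ x, 0 ≤ v x := fun x => zero_le_one.trans (hv1 x)
  set a : ℝ → PhaseSpace N → ℝ := fun δ x => (s δ x - s δ (x.1, -x.2)) ^ 2 with ha
  have ham : ∀ δ, Measurable (a δ) := fun δ => ((hs δ).sub ((hs δ).comp hΘm)).pow_const 2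
  have ha0 : ∀ δ x, 0 ≤ a δ x := fun δ x => sq_nonneg _
  have hvη₀ : ∀ x, v x ≤ Real.exp η * Real.exp (η₀ * Hm x) := fun x =>
    (cosh_mul_one_add_le (η₁ := η) (abs_of_pos hη).le (hH0 x)).trans
      (mul_le_mul_of_nonneg_left (Real.exp_le_exp.2 (mul_le_mul_of_nonneg_right hηη₀.le (hH0 x)))
        (Real.exp_pos _).le)
  -- (H1): eventual integrability of `a_δ v`
  obtain ⟨C, hC⟩ := H1
  have hint : ∀ᶠ δ in 𝓝[≠] (0 : ℝ), Integrable (fun x => a δ x * v x) volume := by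
    filter_upwards [hC] with δ hδ
    refine Integrable.mono' (hδ.1.const_mul (Real.exp η))
      ((ham δ).mul hvc.measurable).aestronglyMeasurable (Eventually.of_forall fun x => ?_)
    rw [Real.norm_eq_abs, abs_of_nonneg (mul_nonneg (ha0 δ x) (hv0 x))]
    calc a δ x * v x ≤ a δ x * (Real.exp η * Real.exp (η₀ * Hm x)) :=
          mul_le_mul_of_nonneg_left (hvη₀ x) (ha0 δ x)
      _ = Real.exp η * (a δ x * Real.exp (η₀ * Hm x)) := by ring
  refine ⟨hint, ?_⟩
  -- the Gibbs density and the limit function `G = (½(h-h∘Θ)√ρ_T)² v`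
  have hρint : Integrable (P.gibbsDensity N T) := pinnedChain_integrable_gibbsDensity hω hl.le hβ.le γ N hT
  have hρint' : Integrable (fun x => Real.exp (-Hm x / T)) (volume : Measure (PhaseSpace N)) := hρint
  have hZpos : 0 < ∫ y, P.gibbsDensity N T y := integral_exp_pos hρint
  have hρ0 : ∀ x, 0 ≤ P.gibbsDensity N T x / ∫ y, P.gibbsDensity N T y := fun x =>
    div_nonneg (Real.exp_pos _).le hZpos.le
  have hρc : Continuous (P.gibbsDensity N T) := pinnedChain_continuous_gibbsDensity ω₂ lam β γ N T
  set g : PhaseSpace N → ℝ := fun x => (1 / 2 : ℝ) * (h x - h (x.1, -x.2)) *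
    Real.sqrt (P.gibbsDensity N T x / ∫ y, P.gibbsDensity N T y) with hg
  set G : PhaseSpace N → ℝ := fun x => g x ^ 2 * v x with hGdef
  have e : ∀ x, G x = (1 / 4 : ℝ) * (∫ y, P.gibbsDensity N T y)⁻¹ *
      ((h x - h (x.1, -x.2)) ^ 2 * Real.cosh (η * (1 + Hm x)) * P.gibbsDensity N T x) := fun x => by
    simp only [hGdef, hg, hv]
    rw [mul_pow, mul_pow, Real.sq_sqrt (hρ0 x)]
    ring
  -- measurability of `h`, `h∘Θ`, `g` for Lebesgue measure
  rw [hG] at hmem hlimInt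
  have hvol : (volume : Measure (PhaseSpace N)) ≪ P.gibbsMeasure N T := absolutelyContinuous_tilted hρint
  have hhm : AEStronglyMeasurable h (volume : Measure (PhaseSpace N)) := hmem.1.mono_ac hvol
  have hhΘm : AEStronglyMeasurable (fun x : PhaseSpace N => h (x.1, -x.2)) (volume : Measure (PhaseSpace N)) :=
    hhm.comp_quasiMeasurePreserving (measurePreserving_momentumReversal N).quasiMeasurePreserving
  have hgm : AEStronglyMeasurable g (volume : Measure (PhaseSpace N)) :=
    ((hhm.sub hhΘm).const_mul (1 / 2 : ℝ)).mul
      (Real.continuous_sqrt.comp (hρc.div_const _)).aestronglyMeasurable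
  -- integrability of the limit (helper file 1) and the value of its integral
  have hlimInt' : Integrable (fun x => (h x - h (x.1, -x.2)) ^ 2 * Real.cosh (η * (1 + Hm x)) *
      P.gibbsDensity N T x) (volume : Measure (PhaseSpace N)) := by
    have h1 := (integrable_tilted_iff hρint' _).1 hlimInt
    refine h1.congr (Eventually.of_forall fun x => ?_)
    show Real.exp (-Hm x / T) • ((h x - h (x.1, -x.2)) ^ 2 * Real.cosh (η * (1 + Hm x))) =
      (h x - h (x.1, -x.2)) ^ 2 * Real.cosh (η * (1 + Hm x)) * P.gibbsDensity N T x
    rw [smul_eq_mul, show P.gibbsDensity N T x = Real.exp (-Hm x / T) from rfl]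
    ring
  have hGfun : G = fun x => (1 / 4 : ℝ) * (∫ y, P.gibbsDensity N T y)⁻¹ *
      ((h x - h (x.1, -x.2)) ^ 2 * Real.cosh (η * (1 + Hm x)) * P.gibbsDensity N T x) := funext e
  have hGint : Integrable G (volume : Measure (PhaseSpace N)) := by
    rw [hGfun]; exact hlimInt'.const_mul _
  have hGval : ∫ x, G x = (1 / 4 : ℝ) * ∫ x, (h x - h (x.1, -x.2)) ^ 2 *
      Real.cosh (η * (1 + Hm x)) ∂(P.gibbsMeasure N T) := by
    rw [P.integral_gibbsMeasure, hGfun, integral_const_mul, mul_assoc]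
  have hg2int : Integrable (fun x => g x ^ 2) (volume : Measure (PhaseSpace N)) := by
    refine Integrable.mono' hGint (hgm.pow 2) (Eventually.of_forall fun x => ?_)
    rw [Real.norm_eq_abs, abs_of_nonneg (sq_nonneg _)]
    show g x ^ 2 ≤ g x ^ 2 * v x
    exact le_mul_of_one_le_right (sq_nonneg _) (hv1 x)
  -- energy sublevel sets exhaust phase space
  set S : ℕ → Set (PhaseSpace N) := fun n => {x | Hm x ≤ n} with hS
  have hSm : ∀ n, MeasurableSet (S n) := fun n => measurableSet_le hHc.measurable measurable_const
  have hSmono : Monotone S := fun m n hmn x hx => le_trans (b := (m : ℝ)) hx (by exact_mod_cast hmn)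
  have hSU : (⋃ n, S n) = Set.univ := by
    refine Set.eq_univ_of_forall fun x => ?_
    obtain ⟨n, hn⟩ := exists_nat_ge (Hm x)
    exact Set.mem_iUnion.2 ⟨n, hn⟩
  -- the main convergence, for `f_δ = δ⁻² a_δ v`
  have final : Tendsto (fun δ : ℝ => ∫ x, (δ ^ 2)⁻¹ * (a δ x * v x)) (𝓝[≠] (0 : ℝ)) (𝓝 (∫ x, G x)) := by
    refine tendsto_integral_of_local_of_tight hSm hSmono hSU hGint ?_ ?_ ?_ ?_
    · filter_upwards [hint] with δ hδ
      exact hδ.const_mul _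
    · exact Eventually.of_forall fun δ x =>
        mul_nonneg (inv_nonneg.2 (sq_nonneg δ)) (mul_nonneg (ha0 δ x) (hv0 x))
    · -- local convergence on `S n`: (H2) and the `L²(S)` lemma
      intro n
      obtain ⟨H2i, H2lim⟩ := H2 n
      have hW : 0 ≤ Real.cosh (η * (1 + n)) := (Real.cosh_pos _).le
      have hwW : ∀ᵐ x ∂((volume : Measure (PhaseSpace N)).restrict (S n)), v x ≤ Real.cosh (η * (1 + n)) := by
        filter_upwards [ae_restrict_mem (hSm n)] with x hx
        have hx' : Hm x ≤ n := hx
        show Real.cosh (η * (1 + Hm x)) ≤ Real.cosh (η * (1 + n))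
        rw [Real.cosh_le_cosh, abs_of_nonneg (mul_nonneg hη.le (by linarith [hH0 x])),
          abs_of_nonneg (mul_nonneg hη.le (by positivity))]
        exact mul_le_mul_of_nonneg_left (by linarith) hη.le
      have hFm : ∀ᶠ δ in 𝓝[≠] (0 : ℝ), AEStronglyMeasurable (fun x : PhaseSpace N =>
          δ⁻¹ * (s δ x - s δ (x.1, -x.2))) ((volume : Measure (PhaseSpace N)).restrict (S n)) :=
        Eventually.of_forall fun δ =>
          (measurable_const.mul ((hs δ).sub ((hs δ).comp hΘm))).aestronglyMeasurable
      have key := tendsto_setIntegral_sq_mul_of_tendsto_setIntegral_sub_sq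
        (F := fun (δ : ℝ) (x : PhaseSpace N) => δ⁻¹ * (s δ x - s δ (x.1, -x.2))) (G := g) hW
        hvc.aestronglyMeasurable.restrict (Eventually.of_forall fun x => hv0 x) hwW hFm
        hg2int.integrableOn H2i H2lim
      refine key.congr fun δ => integral_congr_ae (Eventually.of_forall fun x => ?_)
      show (δ⁻¹ * (s δ x - s δ (x.1, -x.2))) ^ 2 * v x = (δ ^ 2)⁻¹ * ((s δ x - s δ (x.1, -x.2)) ^ 2 * v x)
      rw [mul_pow, inv_pow]; ring
    · -- tightness from (H1) and the tail weight gap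
      intro ε hε
      set r : ℝ := Real.exp (-(η₀ - η)) with hr
      have hr0 : 0 ≤ r := (Real.exp_pos _).le
      have hr1 : r < 1 := Real.exp_lt_one_iff.2 (by linarith)
      have hB : Tendsto (fun n : ℕ => Real.exp η * max C 0 * r ^ n) atTop (𝓝 0) := by
        have := (tendsto_pow_atTop_nhds_zero_of_lt_one hr0 hr1).const_mul (Real.exp η * max C 0)
        rwa [mul_zero] at this
      filter_upwards [(tendsto_order.1 hB).2 ε hε] with n hn
      filter_upwards [hC, hint, (eventually_mem_nhdsWithin : ∀ᶠ δ in 𝓝[≠] (0 : ℝ), δ ∈ ({0}ᶜ : Set ℝ))]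
        with δ hδ hIv hδ0
      have hδ0' : δ ≠ 0 := hδ0
      have hδ2 : 0 < δ ^ 2 := by positivity
      have hIexp := hδ.1
      have step1 : ∫ x in (S n)ᶜ, a δ x * v x ≤
          ∫ x in (S n)ᶜ, Real.exp η * r ^ n * (a δ x * Real.exp (η₀ * Hm x)) := by
        refine setIntegral_mono_on hIv.integrableOn (hIexp.const_mul _).integrableOn (hSm n).compl
          fun x hx => ?_
        have hx' : (n : ℝ) ≤ Hm x := le_of_lt (not_le.1 hx)
        calc a δ x * v x ≤ a δ x * (Real.exp η * r ^ n * Real.exp (η₀ * Hm x)) :=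
              mul_le_mul_of_nonneg_left (cosh_le_tail_gap hη hηη₀ (hH0 x) hx') (ha0 δ x)
          _ = _ := by ring
      have step2 : ∫ x in (S n)ᶜ, Real.exp η * r ^ n * (a δ x * Real.exp (η₀ * Hm x)) ≤
          Real.exp η * r ^ n * (C * δ ^ 2) := by
        rw [integral_const_mul]
        refine mul_le_mul_of_nonneg_left ?_ (by positivity)
        exact (setIntegral_le_integral hIexp (Eventually.of_forall fun x =>
          mul_nonneg (ha0 δ x) (Real.exp_pos _).le)).trans hδ.2
      rw [integral_const_mul]
      calc (δ ^ 2)⁻¹ * ∫ x in (S n)ᶜ, a δ x * v x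
          ≤ (δ ^ 2)⁻¹ * (Real.exp η * r ^ n * (C * δ ^ 2)) :=
            mul_le_mul_of_nonneg_left (step1.trans step2) (inv_nonneg.2 hδ2.le)
        _ = Real.exp η * C * r ^ n := by field_simp
        _ ≤ Real.exp η * max C 0 * r ^ n := by gcongr; exact le_max_left _ _
        _ ≤ ε := hn.le
  rw [hGval] at final
  rw [hG]
  exact final.congr fun δ => integral_const_mul _ _

end Pinned


/-! ## Registered helper stub -/

/-- **Registered helper stub of this file** (`helper_weightedOddDQMAssembly`, the reduction of
clause (ii) of stub `stub_weightedOddDQM` (S_H2) of crux stmt-AtomisticToContinuum-9121, line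
`hellinger-logmean`): under weak-NESS uniqueness, along a steady-state family, for `T > 0`, `N ≥ 2`,
an `L²` response density `h`, `0 < η₀ ≤ 1/T` and a measurable family `s_δ`:
(H1) weighted tightness `∫ (s_δ - s_δ∘Θ)² e^{η₀H} dx ≤ C δ²` (eventually, integrand integrable) →
(H2) local quadratic-mean convergence `δ⁻¹(s_δ - s_δ∘Θ) → ½(h - h∘Θ)√ρ_T` in `L²({H ≤ R}, dx)`
for every `R` → for every `0 < η < η₀`: eventual integrability of `(s_δ - s_δ∘Θ)² cosh(η(1+H))` and
`δ⁻² ∫ (s_δ - s_δ∘Θ)² cosh(η(1+H)) dx → ¼ ∫ (h - h∘Θ)² cosh(η(1+H)) dμ_{N,T,T}`.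
[folklore] -/
theorem helper_weightedOddDQMAssembly : ∀ ω₂ lam β γ : ℝ, 0 < ω₂ → 0 < lam → 0 < β → 0 < γ → (∀ (N : ℕ) (T_L T_R : ℝ), 0 < T_L → 0 < T_R → ∀ μ ν : Measure (PhaseSpace N), (pinnedChain ω₂ lam β γ).IsSteadyState N T_L T_R μ → (pinnedChain ω₂ lam β γ).IsSteadyState N T_L T_R ν → μ = ν) → ∀ μ : (N : ℕ) → ℝ → ℝ → Measure (PhaseSpace N), (∀ (N : ℕ) (T_L T_R : ℝ), 0 < T_L → 0 < T_R → (pinnedChain ω₂ lam β γ).IsSteadyState N T_L T_R (μ N T_L T_R)) → ∀ T : ℝ, 0 < T → ∀ N : ℕ, 2 ≤ N → ∀ h : PhaseSpace N → ℝ, (MemLp h 2 (μ N T T) ∧ (∀ F : PhaseSpace N → ℝ, ContDiff ℝ ((⊤ : ℕ∞) : WithTop ℕ∞) F → HasCompactSupport F → Tendsto (fun δ : ℝ => ((∫ x, F x ∂(μ N (T + δ / 2) (T - δ / 2))) - ∫ x, F x ∂(μ N T T)) / δ) (𝓝[≠] (0 : ℝ)) (𝓝 (∫ x, F x * h x ∂(μ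 N T T)))) ∧ (∀ i : Fin N, Tendsto (fun δ : ℝ => ((∫ x, (pinnedChain ω₂ lam β γ).bondCurrent N i x ∂(μ N (T + δ / 2) (T - δ / 2))) - ∫ x, (pinnedChain ω₂ lam β γ).bondCurrent N i x ∂(μ N T T)) / δ) (𝓝[≠] (0 : ℝ)) (𝓝 (∫ x, (pinnedChain ω₂ lam β γ).bondCurrent N i x * h x ∂(μ N T T))))) → ∀ η₀ : ℝ, 0 < η₀ → η₀ ≤ 1 / T → ∀ s : ℝ → PhaseSpace N → ℝ, (∀ δ, Measurable (s δ)) → (∃ C : ℝ, ∀ᶠ δ in 𝓝[≠] (0 : ℝ), Integrable (fun x : PhaseSpace N => (s δ x - s δ (x.1, -x.2)) ^ 2 * Real.exp (η₀ * (pinnedChain ω₂ lam β γ).hamiltonian N x)) (volume : Measure (PhaseSpace N)) ∧ ∫ x, (s δ x - s δ (x.1, -x.2)) ^ 2 * Real.exp (η₀ * (pinnedChain ω₂ lam β γ).hamiltonian N x) ∂(volume : Measure (PhaseSpace N)) ≤ C * δ ^ 2) → (∀ R : ℝ, (∀ᶠ δ in 𝓝[≠] (0 : ℝ), IntegrableOn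 (fun x : PhaseSpace N => (δ⁻¹ * (s δ x - s δ (x.1, -x.2)) - (1 / 2 : ℝ) * (h x - h (x.1, -x.2)) * Real.sqrt ((pinnedChain ω₂ lam β γ).gibbsDensity N T x / ∫ y, (pinnedChain ω₂ lam β γ).gibbsDensity N T y)) ^ 2) {x | (pinnedChain ω₂ lam β γ).hamiltonian N x ≤ R} (volume : Measure (PhaseSpace N))) ∧ Tendsto (fun δ : ℝ => ∫ x in {x | (pinnedChain ω₂ lam β γ).hamiltonian N x ≤ R}, (δ⁻¹ * (s δ x - s δ (x.1, -x.2)) - (1 / 2 : ℝ) * (h x - h (x.1, -x.2)) * Real.sqrt ((pinnedChain ω₂ lam β γ).gibbsDensity N T x / ∫ y, (pinnedChain ω₂ lam β γ).gibbsDensity N T y)) ^ 2 ∂(volume : Measure (PhaseSpace N))) (𝓝[≠] (0 : ℝ)) (𝓝 0)) → ∀ η : ℝ, 0 < η → η < η₀ → (∀ᶠ δ in 𝓝[≠] (0 : ℝ), Integrable (fun x : PhaseSpace N => (s δ x - s δ (x.1, -x.2)) ^ 2 * Real.cosh (η * (1 + (pinnedChain ω₂ lam β γ).hamiltonian N x)))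 (volume : Measure (PhaseSpace N))) ∧ Tendsto (fun δ : ℝ => (δ ^ 2)⁻¹ * ∫ x, (s δ x - s δ (x.1, -x.2)) ^ 2 * Real.cosh (η * (1 + (pinnedChain ω₂ lam β γ).hamiltonian N x)) ∂(volume : Measure (PhaseSpace N))) (𝓝[≠] (0 : ℝ)) (𝓝 ((1 / 4 : ℝ) * ∫ x, (h x - h (x.1, -x.2)) ^ 2 * Real.cosh (η * (1 + (pinnedChain ω₂ lam β γ).hamiltonian N x)) ∂(μ N T T))) :=
  fun _ _ _ _ hω hl hβ hγ hU _ hμ _ hT _ hN _ hh _ _ hη₀T _ hs H1 H2 _ hη hηη₀ =>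
    weightedOddDQM_of_tight_of_local hω hl hβ hγ hU hμ hT hN hh hη₀T hs H1 H2 hη hηη₀

end Summit.AtomisticToContinuum.FouriersLaw.Theorems.ExtensiveSnapshotIrreversibility.HellingerLogMean

end
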